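import Literature.MathematicalPhysics.QuantumFieldTheory.ConformalBootstrap3D.BlockPoleNonexistence
import Mathlib.Analysis.Normed.Group.Tannery
import Mathlib.Analysis.SpecialFunctions.Pow.Continuity
import Mathlib.Tactic
import HarnessLib

/-!
# The free-scalar pole of the 3D blocks: `ℓ = 0`, `Δ → 1/2`

Kos–Poland–Simmons-Duffin 2014 §4 (eqs. (4.2)–(4.3), Table 1): the second family of poles of the scalar
conformal block `g^{Δ₁₂,Δ₃₄}_{Δ,ℓ}` in `Δ` sits at `Δ = d/2 - k`; at `k = 1`, `d = 3` this is the free-scalar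
point `(Δ, ℓ) = (1/2, 0)`, the unitarity bound of a scalar, with null descendant `(Δ + 2, ℓ) = (5/2, 0)`
(the state `□φ` of a free field). This file proves, for the typed 3D blocks of the `σ–ε` system and from the
Dolan–Osborn recursion alone:

* `tendsto_sub_half_mul_hrCoeffAB` — COEFFICIENT level: for every `a, b`, every level `n` and spin `j`,
  `(Δ - 1/2) · A_{n+2,j}(a,b; Δ, 0) → freeScalarResidueConst a b · A_{n,j}(a,b; 5/2, 0)` as `Δ → 1/2`,
  `Δ ≠ 1/2`, with `freeScalarResidueConst a b = (16a² - 1)(16b² - 1)/192`; levels `0, 1` are regular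
  (`tendsto_sub_half_mul_hrCoeffAB_zero/one`). The mechanism is that of `MixedBlockResidue`: the pivot of
  `(2, 0)` is `4(Δ - 1/2)`, and the null state has the same Casimir, `C_{1/2+n+2,j} - C_{1/2,0} =
  C_{5/2+n,j} - C_{5/2,0}` (`casimirPivot3D_half_add_two`);
* `tendsto_sub_half_mul_hrBlockAB` — VALUE level: `(Δ - 1/2) · g^{Δ₁₂,Δ₃₄}_{Δ,0}(z,z̄) →
  freeScalarBlockResidueConst Δ₁₂ Δ₃₄ · g^{Δ₁₂,Δ₃₄}_{5/2,0}(z,z̄)` pointwise on `(0,1)²` as `Δ ↓ 1/2`, with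
  `freeScalarBlockResidueConst Δ₁₂ Δ₃₄ = (4Δ₁₂² - 1)(4Δ₃₄² - 1)/192` (no normalisation change: both blocks
  have spin `0`);
* `not_isConformalBlock3D_freeScalar` — **for `|Δ₁₂| ≠ 1/2` and `|Δ₃₄| ≠ 1/2` NO function satisfies
  `IsConformalBlock3D Δ₁₂ Δ₃₄ (1/2) 0`**; in particular (`Δ₁₂ = Δ₃₄ = 0`) the typed clause A2 excludes an
  exchanged scalar of dimension exactly `1/2` from `σ × σ` and `ε × ε` — "a free scalar cannot appear in the
  OPE of two identical scalars" (equation of motion), the sentence of the `IsConformalBlock3D` docstring, is a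
  theorem for the typed predicate (`SigmaEpsilonData.half_lt_Δp_of_satisfiesBootstrapAxioms`). The residue
  vanishes exactly at `|Δ₁₂| = 1/2` or `|Δ₃₄| = 1/2` — where a free scalar CAN couple (`σ = φ`, `ε = φ²`,
  `Δ_ε - Δ_σ = 1/2`: `φ ∈ φ × φ²`), and the predicate rightly does not exclude it.

The value-level machinery (uniform growth of the regularised arrays near the pole, Tannery, the monomial shift
`e_{N+2,j}(m+1,n+1) = e_{N,j}(m,n)`, non-vanishing of the residue block) is that of `BlockPoleNonexistence`
with the pole moved from `(ℓ+1, ℓ)` to `(1/2, 0)` and the level shift `2` instead of `1`. Exact-rational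
cross-check (483 checks, seven `(a,b)`, levels ≤ 7; literal transcription of the tree definitions):
pub-ising3d `pub-ising3d-lit-g7/code/check_free_scalar_pole.py`. No hypothesis-style fact is introduced.

References: F. Kos, D. Poland, D. Simmons-Duffin, JHEP 11 (2014) 109 [arXiv:1406.4858], §4 eqs. (4.2)–(4.3),
Table 1 (type II, `k = 1`) [cite: KosPolandSimmonsduffin2014, §4 eqs. (4.2)–(4.3)]; F. A. Dolan, H. Osborn,
Nucl. Phys. B 678 (2004) 491, §3 eqs. (3.9)–(3.13) [cite: DolanOsborn2004, §3 eqs. (3.11)–(3.12)];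
M. Hogervorst, S. Rychkov, Phys. Rev. D 87 (2013) 106004, §4.1 after eq. (4.11) ("the singularity first shows
up in the coefficient `B_{2,0} ∼ (Δ-ν)⁻¹`") [cite: HogervorstRychkov2013, §4.1]. Mathlib:
`tendsto_tsum_of_dominated_convergence`, `tendsto_nhds_unique`.
-/

namespace Literature.MathematicalPhysics.QuantumFieldTheory.ConformalBootstrap3D

open Finset Set Filter Topology

/-! ### 0. Small helpers -/

/-- `𝓝[>] x ≤ 𝓝[≠] x`. [folklore] -/
private theorem nhdsGT_le_nhdsNE₂ (x : ℝ) : 𝓝[>] x ≤ 𝓝[≠] x :=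
  nhdsWithin_mono _ fun _ hy => ne_of_gt hy

/-- The scalar unitarity bound is `1/2`. [cite: HogervorstRychkov2013, §2] -/
private theorem unitarityBound3D_zero' : unitarityBound3D 0 = 1 / 2 := by
  simp [unitarityBound3D]

/-- `5/2` lies above the scalar unitarity bound. [folklore] -/
private theorem unitarityBound3D_zero_lt_five_halves : unitarityBound3D 0 < (5 : ℝ) / 2 := by
  rw [unitarityBound3D_zero']; norm_num

/-! ### 1. The residue at coefficient level -/

section Coefficients

variable (a b : ℝ)

/-- The residue constant of the free-scalar pole: `(16a² - 1)(16b² - 1)/192 =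
γ⁻_{3/2,1}(a,b) · γ⁺_{1/2,0}(a,b) / 4` (Kos–Poland–Simmons-Duffin 2014 Table 1, type II, `k = 1`, at `d = 3`,
in Hogervorst–Rychkov normalisation). [cite: KosPolandSimmonsduffin2014, §4 Table 1] -/
noncomputable def freeScalarResidueConst : ℝ :=
  (16 * a ^ 2 - 1) * (16 * b ^ 2 - 1) / 192

/-- **The null state has the same Casimir**: `C_{1/2+n+2,j} - C_{1/2,0} = C_{5/2+n,j} - C_{5/2,0}`
(`C_{1/2,0} = C_{5/2,0} = -5/8` in the `d = 3` normalisation). [cite: KosPolandSimmonsduffin2014, §4 eq. (4.3)] -/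
theorem casimirPivot3D_half_add_two (n j : ℕ) :
    casimirPivot3D (1 / 2) 0 (n + 2) j = casimirPivot3D (5 / 2) 0 n j := by
  unfold casimirPivot3D
  push_cast
  ring

/-- The level-`1` pivots at `Δ = 1/2`, `ℓ = 0` do not vanish: `C_{3/2,j} - C_{1/2,0} = j(j+1) - 1 ≠ 0`.
[folklore] -/
theorem casimirPivot3D_half_one_ne_zero (j : ℕ) : casimirPivot3D (1 / 2) 0 1 j ≠ 0 := by
  unfold casimirPivot3D
  push_cast
  rcases Nat.eq_zero_or_pos j with hj | hj
  · subst hj; norm_num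
  · have hj' : (1 : ℝ) ≤ j := by exact_mod_cast hj
    nlinarith

/-- The regularised array `(Δ - 1/2) · A_{n,j}(a,b;Δ,0)` obeys the same (linear) recursion.
[cite: DolanOsborn2004, §3 eq. (3.12)] -/
theorem sub_half_mul_hrCoeffAB_succ (Δ : ℝ) (n j : ℕ) :
    (Δ - 1 / 2) * hrCoeffAB a b Δ 0 (n + 1) j =
      ((if j = 0 then 0 else hrGammaPlusAB a b (Δ + n) (j - 1) * ((Δ - 1 / 2) * hrCoeffAB a b Δ 0 n (j - 1)))
        + hrGammaMinusAB a b (Δ + n) (j + 1) * ((Δ - 1 / 2) * hrCoeffAB a b Δ 0 n (j + 1))) /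
        casimirPivot3D Δ 0 (n + 1) j := by
  rw [hrCoeffAB_succ, ← mul_div_assoc]
  congr 1
  split_ifs <;> ring

/-- **One step of the limit recursion at the free-scalar pole.** [cite: DolanOsborn2004, §3 eq. (3.12)] -/
theorem tendsto_sub_half_mul_hrCoeffAB_succ {n j : ℕ} {L₁ L₂ : ℝ}
    (h₁ : Tendsto (fun Δ : ℝ => (Δ - 1 / 2) * hrCoeffAB a b Δ 0 n (j - 1)) (𝓝[≠] (1 / 2 : ℝ)) (𝓝 L₁))
    (h₂ : Tendsto (fun Δ : ℝ => (Δ - 1 / 2) * hrCoeffAB a b Δ 0 n (j + 1)) (𝓝[≠] (1 / 2 : ℝ)) (𝓝 L₂))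
    (hp : casimirPivot3D (1 / 2) 0 (n + 1) j ≠ 0) :
    Tendsto (fun Δ : ℝ => (Δ - 1 / 2) * hrCoeffAB a b Δ 0 (n + 1) j) (𝓝[≠] (1 / 2 : ℝ))
      (𝓝 (((if j = 0 then 0 else hrGammaPlusAB a b (1 / 2 + n) (j - 1) * L₁)
        + hrGammaMinusAB a b (1 / 2 + n) (j + 1) * L₂) / casimirPivot3D (1 / 2) 0 (n + 1) j)) := by
  have hfun : (fun Δ : ℝ => (Δ - 1 / 2) * hrCoeffAB a b Δ 0 (n + 1) j) = fun Δ : ℝ =>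
      ((if j = 0 then 0 else hrGammaPlusAB a b (Δ + n) (j - 1) * ((Δ - 1 / 2) * hrCoeffAB a b Δ 0 n (j - 1)))
        + hrGammaMinusAB a b (Δ + n) (j + 1) * ((Δ - 1 / 2) * hrCoeffAB a b Δ 0 n (j + 1))) /
        casimirPivot3D Δ 0 (n + 1) j := funext fun Δ => sub_half_mul_hrCoeffAB_succ a b Δ n j
  rw [hfun]
  have hγp : Tendsto (fun Δ : ℝ => hrGammaPlusAB a b (Δ + n) (j - 1)) (𝓝[≠] (1 / 2 : ℝ))
      (𝓝 (hrGammaPlusAB a b (1 / 2 + n) (j - 1))) :=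
    ((continuous_hrGammaPlusAB a b n (j - 1)).tendsto _).mono_left nhdsWithin_le_nhds
  have hγm : Tendsto (fun Δ : ℝ => hrGammaMinusAB a b (Δ + n) (j + 1)) (𝓝[≠] (1 / 2 : ℝ))
      (𝓝 (hrGammaMinusAB a b (1 / 2 + n) (j + 1))) :=
    ((continuous_hrGammaMinusAB a b n (j + 1)).tendsto _).mono_left nhdsWithin_le_nhds
  have hpiv : Tendsto (fun Δ : ℝ => casimirPivot3D Δ 0 (n + 1) j) (𝓝[≠] (1 / 2 : ℝ))
      (𝓝 (casimirPivot3D (1 / 2) 0 (n + 1) j)) :=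
    ((continuous_casimirPivot3D 0 (n + 1) j).tendsto _).mono_left nhdsWithin_le_nhds
  refine Tendsto.div (Tendsto.add ?_ (hγm.mul h₂)) hpiv hp
  by_cases hj : j = 0
  · simp only [hj, if_true]
    exact tendsto_const_nhds
  · simp only [hj, if_false]
    exact hγp.mul h₁

/-- Level zero is regular: `(Δ - 1/2) A_{0,j} → 0`. [folklore] -/
theorem tendsto_sub_half_mul_hrCoeffAB_zero (j : ℕ) :
    Tendsto (fun Δ : ℝ => (Δ - 1 / 2) * hrCoeffAB a b Δ 0 0 j) (𝓝[≠] (1 / 2 : ℝ)) (𝓝 0) := by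
  have hfun : (fun Δ : ℝ => (Δ - 1 / 2) * hrCoeffAB a b Δ 0 0 j) =
      fun Δ : ℝ => (Δ - 1 / 2) * (if j = 0 then 1 else 0) := by
    funext Δ
    by_cases h : j = 0
    · subst h; simp
    · rw [hrCoeffAB_zero_of_ne a b Δ h, if_neg h]
  rw [hfun]
  have hc : Continuous fun Δ : ℝ => (Δ - 1 / 2) * (if j = 0 then (1 : ℝ) else 0) := by fun_prop
  exact (hc.tendsto' (1 / 2) 0 (by simp)).mono_left nhdsWithin_le_nhds

/-- Level one is regular: `(Δ - 1/2) A_{1,j} → 0` (pivots `j(j+1) - 1 ≠ 0`). [folklore] -/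
theorem tendsto_sub_half_mul_hrCoeffAB_one (j : ℕ) :
    Tendsto (fun Δ : ℝ => (Δ - 1 / 2) * hrCoeffAB a b Δ 0 1 j) (𝓝[≠] (1 / 2 : ℝ)) (𝓝 0) := by
  have h := tendsto_sub_half_mul_hrCoeffAB_succ a b (n := 0) (j := j)
    (tendsto_sub_half_mul_hrCoeffAB_zero a b (j - 1)) (tendsto_sub_half_mul_hrCoeffAB_zero a b (j + 1))
    (casimirPivot3D_half_one_ne_zero j)
  simpa using h

/-- `A_{1,1}(a,b;Δ,0) = γ⁺_{Δ,0}(a,b) / (C_{Δ+1,1} - C_{Δ,0})`. [cite: DolanOsborn2004, §3 eq. (3.12)] -/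
theorem hrCoeffAB_scalar_one_one (Δ : ℝ) :
    hrCoeffAB a b Δ 0 1 1 = hrGammaPlusAB a b Δ 0 / casimirPivot3D Δ 0 1 1 := by
  change hrCoeffAB a b Δ 0 (0 + 1) 1 = _
  rw [hrCoeffAB_succ]
  have h02 : hrCoeffAB a b Δ 0 0 (1 + 1) = 0 := hrCoeffAB_zero_of_ne a b Δ (by norm_num)
  simp [h02]

/-- `A_{2,0}(a,b;Δ,0) = γ⁻_{Δ+1,1}(a,b) A_{1,1} / (C_{Δ+2,0} - C_{Δ,0})`. [cite: DolanOsborn2004, §3 eq. (3.12)] -/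
theorem hrCoeffAB_scalar_two_zero (Δ : ℝ) :
    hrCoeffAB a b Δ 0 2 0 =
      hrGammaMinusAB a b (Δ + 1) 1 * hrCoeffAB a b Δ 0 1 1 / casimirPivot3D Δ 0 2 0 := by
  change hrCoeffAB a b Δ 0 (1 + 1) 0 = _
  rw [hrCoeffAB_succ]
  simp

/-- The pivot of `(2, 0)` at `ℓ = 0` is `4(Δ - 1/2)`. [cite: HogervorstRychkov2013, §4.1] -/
theorem casimirPivot3D_scalar_two_zero (Δ : ℝ) : casimirPivot3D Δ 0 2 0 = 4 * (Δ - 1 / 2) := by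
  unfold casimirPivot3D; push_cast; ring

/-- The pivot of `(1, 1)` at `ℓ = 0` is `2Δ`. [cite: HogervorstRychkov2013, §4.1] -/
theorem casimirPivot3D_scalar_one_one (Δ : ℝ) : casimirPivot3D Δ 0 1 1 = 2 * Δ := by
  unfold casimirPivot3D; push_cast; ring

/-- **The pole entry**: `(Δ - 1/2) A_{2,0}(a,b;Δ,0) → freeScalarResidueConst a b` (`= γ⁻_{3/2,1} γ⁺_{1/2,0}/4`;
Hogervorst–Rychkov: "the singularity first shows up in `B_{2,0} ∼ (Δ-ν)⁻¹`"). [cite: HogervorstRychkov2013, §4.1] -/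
theorem tendsto_sub_half_mul_hrCoeffAB_two_zero :
    Tendsto (fun Δ : ℝ => (Δ - 1 / 2) * hrCoeffAB a b Δ 0 2 0) (𝓝[≠] (1 / 2 : ℝ))
      (𝓝 (freeScalarResidueConst a b)) := by
  -- the regularised entry is a continuous function near `Δ = 1/2` (off `Δ = 0`, where `C_{Δ+1,1}-C_{Δ,0} = 2Δ` vanishes)
  set φ : ℝ → ℝ := fun Δ =>
    hrGammaMinusAB a b (Δ + 1) 1 * hrGammaPlusAB a b (Δ + 0) 0 / (8 * Δ) with hφ
  have hcont : ContinuousAt φ (1 / 2) :=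
    ((((continuous_hrGammaMinusAB a b 1 1).mul (continuous_hrGammaPlusAB a b 0 0)).continuousAt).div
      ((continuous_const.mul continuous_id).continuousAt) (by norm_num))
  have hval : φ (1 / 2) = freeScalarResidueConst a b := by
    simp only [hφ]
    unfold hrGammaMinusAB hrGammaPlusAB freeScalarResidueConst
    push_cast
    ring
  have hne0 : ∀ᶠ Δ in 𝓝[≠] (1 / 2 : ℝ), Δ ≠ 0 :=
    (eventually_ne_nhds (by norm_num : (1 / 2 : ℝ) ≠ 0)).filter_mono nhdsWithin_le_nhds
  have heq : ∀ᶠ Δ in 𝓝[≠] (1 / 2 : ℝ), φ Δ = (Δ - 1 / 2) * hrCoeffAB a b Δ 0 2 0 := by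
    filter_upwards [hne0, self_mem_nhdsWithin] with Δ hΔ0 hΔ
    have hne : Δ - 1 / 2 ≠ 0 := sub_ne_zero.mpr hΔ
    rw [hrCoeffAB_scalar_two_zero, hrCoeffAB_scalar_one_one, casimirPivot3D_scalar_two_zero,
      casimirPivot3D_scalar_one_one]
    simp only [hφ, add_zero]
    -- the factor `Δ - 1/2` cancels as an independent atom
    generalize Δ - 1 / 2 = δ at hne ⊢
    field_simp
    ring
  have h := (hcont.tendsto.mono_left (nhdsWithin_le_nhds (s := ({(1 / 2 : ℝ)}ᶜ : Set ℝ))))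
  rw [hval] at h
  exact h.congr' heq

/-- **Level two**: `(Δ - 1/2) A_{2,j}(a,b;Δ,0) → freeScalarResidueConst a b · A_{0,j}(a,b;5/2,0)` (`j = 0`:
the pole; `j = 2`: regular; other `j`: identically `0`). [cite: KosPolandSimmonsduffin2014, §4 eqs. (4.2)–(4.3)] -/
theorem tendsto_sub_half_mul_hrCoeffAB_two (j : ℕ) :
    Tendsto (fun Δ : ℝ => (Δ - 1 / 2) * hrCoeffAB a b Δ 0 2 j) (𝓝[≠] (1 / 2 : ℝ))
      (𝓝 (freeScalarResidueConst a b * hrCoeffAB a b (5 / 2) 0 0 j)) := by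
  by_cases hj0 : j = 0
  · subst hj0
    rw [hrCoeffAB_zero_self, mul_one]
    exact tendsto_sub_half_mul_hrCoeffAB_two_zero a b
  · rw [hrCoeffAB_zero_of_ne a b _ hj0, mul_zero]
    by_cases hj2 : j = 2
    · subst hj2
      have hp : casimirPivot3D (1 / 2) 0 (1 + 1) 2 ≠ 0 := by unfold casimirPivot3D; push_cast; norm_num
      have h := tendsto_sub_half_mul_hrCoeffAB_succ a b (n := 1) (j := 2)
        (tendsto_sub_half_mul_hrCoeffAB_one a b (2 - 1)) (tendsto_sub_half_mul_hrCoeffAB_one a b (2 + 1)) hp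
      simpa using h
    · have hfun : (fun Δ : ℝ => (Δ - 1 / 2) * hrCoeffAB a b Δ 0 2 j) = fun _ => 0 := by
        funext Δ
        rw [hrCoeffAB_eq_zero_of_not_inDescendantRange a b Δ (fun ⟨_, h2, h3⟩ => by omega), mul_zero]
      rw [hfun]
      exact tendsto_const_nhds

/-- **The residue theorem at the free-scalar pole** (Kos–Poland–Simmons-Duffin 2014 §4, type II, `k = 1`, at
`d = 3`, from the recursion): for every level `n` and spin `j`,
`(Δ - 1/2) · A_{n+2,j}(a,b; Δ, 0) → freeScalarResidueConst a b · A_{n,j}(a,b; 5/2, 0)` as `Δ → 1/2`,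
`Δ ≠ 1/2`: the residue array is the residue constant times the array of the block of the null descendant
`(5/2, 0)` with the same `(Δ₁₂, Δ₃₄)`, shifted by two levels. [cite: KosPolandSimmonsduffin2014, §4 eqs. (4.2)–(4.3)] -/
theorem tendsto_sub_half_mul_hrCoeffAB :
    ∀ n j : ℕ, Tendsto (fun Δ : ℝ => (Δ - 1 / 2) * hrCoeffAB a b Δ 0 (n + 2) j) (𝓝[≠] (1 / 2 : ℝ))
      (𝓝 (freeScalarResidueConst a b * hrCoeffAB a b (5 / 2) 0 n j)) := by
  intro n
  induction n with
  | zero => exact tendsto_sub_half_mul_hrCoeffAB_two a b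
  | succ n ih =>
    intro j
    have hΔ' := unitarityBound3D_zero_lt_five_halves
    by_cases hr : InDescendantRange 0 (n + 1) j
    · -- regular pivot: the recursion passes to the limit
      obtain ⟨h1, h2, h3⟩ := hr
      have hpiv' : 0 < casimirPivot3D (5 / 2) 0 (n + 1) j :=
        casimirPivot3D_pos hΔ' (by omega) h1 h2 h3
      have hp : casimirPivot3D (1 / 2) 0 (n + 2 + 1) j ≠ 0 := by
        rw [show n + 2 + 1 = (n + 1) + 2 by ring, casimirPivot3D_half_add_two]; exact hpiv'.ne'
      have h := tendsto_sub_half_mul_hrCoeffAB_succ a b (ih (j - 1)) (ih (j + 1)) hp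
      refine h.congr' (Eventually.of_forall fun _ => rfl) |>.mono_right (le_of_eq ?_)
      congr 1
      rw [hrCoeffAB_succ, show n + 2 + 1 = (n + 1) + 2 by ring, casimirPivot3D_half_add_two,
        ← mul_div_assoc]
      congr 1
      have hcast : ((1 : ℝ) / 2 + ((n + 2 : ℕ) : ℝ)) = (5 : ℝ) / 2 + (n : ℝ) := by push_cast; ring
      rw [hcast]
      split_ifs <;> ring
    · -- off the shifted range the target is `0`
      rw [hrCoeffAB_eq_zero_of_not_inDescendantRange a b _ hr, mul_zero]
      by_cases hR : InDescendantRange 0 (n + 2 + 1) j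
      · -- only the leading coefficient `j = n + 3` remains
        obtain ⟨h1, h2, h3⟩ := hR
        have hj : j = 0 + (n + 2) + 1 := by
          unfold InDescendantRange at hr
          omega
        subst hj
        have hp : casimirPivot3D (1 / 2) 0 (n + 2 + 1) (0 + (n + 2) + 1) ≠ 0 :=
          (casimirPivot3D_leading_pos (by norm_num : (0 : ℝ) < 1 / 2 + (0 : ℕ)) (n + 2)).ne'
        have hz1 : hrCoeffAB a b (5 / 2) 0 n (0 + (n + 2) + 1 - 1) = 0 :=
          hrCoeffAB_eq_zero_of_not_inDescendantRange a b _ (fun ⟨_, h2', _⟩ => by omega)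
        have hz2 : hrCoeffAB a b (5 / 2) 0 n (0 + (n + 2) + 1 + 1) = 0 :=
          hrCoeffAB_eq_zero_of_not_inDescendantRange a b _ (fun ⟨_, h2', _⟩ => by omega)
        have i1 := ih (0 + (n + 2) + 1 - 1)
        have i2 := ih (0 + (n + 2) + 1 + 1)
        rw [hz1, mul_zero] at i1
        rw [hz2, mul_zero] at i2
        have h := tendsto_sub_half_mul_hrCoeffAB_succ a b i1 i2 hp
        simpa using h
      · have hfun : (fun Δ : ℝ => (Δ - 1 / 2) * hrCoeffAB a b Δ 0 (n + 2 + 1) j) = fun _ => 0 := by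
          funext Δ
          rw [hrCoeffAB_eq_zero_of_not_inDescendantRange a b Δ hR, mul_zero]
        rw [hfun]
        exact tendsto_const_nhds

/-- All levels at once: `(Δ - 1/2) A_{N,j}(a,b;Δ,0) →` the two-level shift of the residue array (`0` for
`N ≤ 1`). [cite: KosPolandSimmonsduffin2014, §4 eqs. (4.2)–(4.3)] -/
theorem tendsto_sub_half_mul_hrCoeffAB_all (N j : ℕ) :
    Tendsto (fun Δ : ℝ => (Δ - 1 / 2) * hrCoeffAB a b Δ 0 N j) (𝓝[≠] (1 / 2 : ℝ))
      (𝓝 (if 2 ≤ N then freeScalarResidueConst a b * hrCoeffAB a b (5 / 2) 0 (N - 2) j else 0)) := by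
  rcases Nat.lt_or_ge N 2 with hN | hN
  · rw [if_neg (by omega)]
    interval_cases N
    · exact tendsto_sub_half_mul_hrCoeffAB_zero a b j
    · exact tendsto_sub_half_mul_hrCoeffAB_one a b j
  · rw [if_pos hN]
    obtain ⟨n, rfl⟩ : ∃ n, N = n + 2 := ⟨N - 2, by omega⟩
    simpa using tendsto_sub_half_mul_hrCoeffAB a b n j

/-- For `|a| = 1/4` or `|b| = 1/4` the residue vanishes: no pole (a free scalar `φ` does couple to `φ × φ²`).
[cite: KosPolandSimmonsduffin2014, §4 Table 1] -/
theorem freeScalarResidueConst_eq_zero_iff :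
    freeScalarResidueConst a b = 0 ↔ 16 * a ^ 2 = 1 ∨ 16 * b ^ 2 = 1 := by
  unfold freeScalarResidueConst
  rw [div_eq_zero_iff, mul_eq_zero]
  constructor
  · rintro (h | h)
    · rcases h with h | h
      · exact Or.inl (by linarith)
      · exact Or.inr (by linarith)
    · norm_num at h
  · rintro (h | h)
    · exact Or.inl (Or.inl (by linarith))
    · exact Or.inl (Or.inr (by linarith))

/-! ### 2. The residue of the monomial coefficients -/

/-- The limit array of `(Δ - 1/2) · k^{ab}_{mn}(Δ, 0)` at `Δ = 1/2`: on degree `N = m + n ≥ 2` the Legendre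
resummation of the residue array (spin-`0` normalisation `λ₀ = 1` on both sides), `0` in degrees `≤ 1`.
[cite: KosPolandSimmonsduffin2014, §4 eqs. (4.2)–(4.3)] -/
noncomputable def freeResCoeffAB (p : ℕ × ℕ) : ℝ :=
  if 2 ≤ p.1 + p.2 then
    ∑ j ∈ range (p.1 + p.2 + 1),
      (freeScalarResidueConst a b * hrCoeffAB a b (5 / 2) 0 (p.1 + p.2 - 2) j / legendreLam 0) *
        legendreArrDeg (p.1 + p.2) j p
  else 0

/-- **Termwise residue**: `(Δ - 1/2) k^{ab}_p(Δ,0) → freeResCoeffAB a b p` as `Δ → 1/2`, `Δ ≠ 1/2`.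
[cite: KosPolandSimmonsduffin2014, §4 eqs. (4.2)–(4.3)] -/
theorem tendsto_sub_half_mul_hrMonomialCoeffAB (p : ℕ × ℕ) :
    Tendsto (fun Δ : ℝ => (Δ - 1 / 2) * hrMonomialCoeffAB a b Δ 0 p) (𝓝[≠] (1 / 2 : ℝ))
      (𝓝 (freeResCoeffAB a b p)) := by
  have hfun : (fun Δ : ℝ => (Δ - 1 / 2) * hrMonomialCoeffAB a b Δ 0 p) = fun Δ : ℝ =>
      ∑ j ∈ range (p.1 + p.2 + 1),
        ((Δ - 1 / 2) * hrCoeffAB a b Δ 0 (p.1 + p.2) j / legendreLam 0) *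
          legendreArrDeg (p.1 + p.2) j p := by
    funext Δ
    rw [hrMonomialCoeffAB_eq_slice a b Δ 0 rfl (Nat.zero_le _)]
    unfold hrSliceAB
    rw [Finset.mul_sum, Nat.sub_zero]
    exact Finset.sum_congr rfl fun j _ => by ring
  rw [hfun]
  rcases Nat.lt_or_ge (p.1 + p.2) 2 with hlt | hge
  · have hres : freeResCoeffAB a b p = 0 := by
      unfold freeResCoeffAB; rw [if_neg (by omega)]
    rw [hres]
    have h := tendsto_finsetSum (range (p.1 + p.2 + 1)) fun j _ =>
      ((tendsto_sub_half_mul_hrCoeffAB_all a b (p.1 + p.2) j).div_const (legendreLam 0)).mul_const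
        (legendreArrDeg (p.1 + p.2) j p)
    simp only [if_neg (show ¬ (2 ≤ p.1 + p.2) by omega), zero_div, zero_mul, sum_const_zero] at h
    exact h
  · have hres : freeResCoeffAB a b p = ∑ j ∈ range (p.1 + p.2 + 1),
        (freeScalarResidueConst a b * hrCoeffAB a b (5 / 2) 0 (p.1 + p.2 - 2) j / legendreLam 0) *
          legendreArrDeg (p.1 + p.2) j p := by
      unfold freeResCoeffAB; rw [if_pos hge]
    rw [hres]
    refine tendsto_finsetSum _ fun j _ => ?_
    have h := ((tendsto_sub_half_mul_hrCoeffAB_all a b (p.1 + p.2) j).div_const (legendreLam 0)).mul_const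
      (legendreArrDeg (p.1 + p.2) j p)
    simp only [if_pos hge] at h
    exact h

/-- **The limit array is the two-level shift of the residue block's array**: `freeResCoeffAB a b (m+1, n+1) =
freeScalarResidueConst a b · k^{ab}_{mn}(5/2, 0)` and `freeResCoeffAB a b (m, 0) = freeResCoeffAB a b (0, n) = 0`
(multiplication of the double series by `z z̄`; no normalisation change). [cite: KosPolandSimmonsduffin2014, §4 eqs. (4.2)–(4.3)] -/
theorem freeResCoeffAB_eq (p : ℕ × ℕ) :
    freeResCoeffAB a b p = freeScalarResidueConst a b *
      (if 1 ≤ p.1 ∧ 1 ≤ p.2 then hrMonomialCoeffAB a b (5 / 2) 0 (p.1 - 1, p.2 - 1) else 0) := by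
  obtain ⟨m, n⟩ := p
  simp only
  -- the residue array vanishes for spins above the shifted range
  have hAtop : ∀ {N j : ℕ}, 2 ≤ N → N - 1 ≤ j → hrCoeffAB a b (5 / 2) 0 (N - 2) j = 0 :=
    fun {N j} hN hj => hrCoeffAB_eq_zero_of_not_inDescendantRange a b _ (fun ⟨_, h2, _⟩ => by omega)
  rcases lt_or_ge (m + n) 2 with hlt | hge
  · -- low degree: both sides vanish
    have hL : freeResCoeffAB a b (m, n) = 0 := by
      unfold freeResCoeffAB; rw [if_neg (by simpa using hlt)]
    rw [hL]
    split_ifs with hmn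
    · exfalso; omega
    · rw [mul_zero]
  · have hL : freeResCoeffAB a b (m, n) = ∑ j ∈ range (m + n + 1),
        (freeScalarResidueConst a b * hrCoeffAB a b (5 / 2) 0 (m + n - 2) j / legendreLam 0) *
          legendreArrDeg (m + n) j (m, n) := by
      unfold freeResCoeffAB; rw [if_pos (by simpa using hge)]
    rw [hL, legendreLam_zero]
    split_ifs with hmn
    · -- interior point: shift identity
      obtain ⟨m', rfl⟩ : ∃ m', m = m' + 1 := ⟨m - 1, by omega⟩
      obtain ⟨n', rfl⟩ : ∃ n', n = n' + 1 := ⟨n - 1, by omega⟩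
      simp only [Nat.add_sub_cancel]
      rw [hrMonomialCoeffAB_eq_slice a b _ 0 (N := m' + n') rfl (Nat.zero_le _)]
      unfold hrSliceAB
      have hsum : m' + 1 + (n' + 1) = m' + n' + 2 := by ring
      have hlev : m' + 1 + (n' + 1) - 2 = m' + n' - 0 := by omega
      rw [hlev, hsum, Finset.sum_range_succ, Finset.sum_range_succ, legendreLam_zero]
      have htop1 : hrCoeffAB a b (5 / 2) 0 (m' + n' - 0) (m' + n' + 1) = 0 :=
        hrCoeffAB_eq_zero_of_not_inDescendantRange a b _ (fun ⟨_, h2, _⟩ => by omega)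
      have htop2 : hrCoeffAB a b (5 / 2) 0 (m' + n' - 0) (m' + n' + 2) = 0 :=
        hrCoeffAB_eq_zero_of_not_inDescendantRange a b _ (fun ⟨_, h2, _⟩ => by omega)
      rw [htop1, htop2, mul_zero, zero_div, zero_mul, add_zero, zero_mul, add_zero, Finset.mul_sum]
      refine Finset.sum_congr rfl fun j hj => ?_
      have hjN : j ≤ m' + n' := by
        have := mem_range.mp hj; omega
      rw [legendreArrDeg_add_two_succ_succ hjN]
      ring
    · -- boundary point `m = 0` or `n = 0`: every term vanishes
      refine (Finset.sum_eq_zero fun j hj => ?_).trans (mul_zero _).symm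
      have hjle : j ≤ m + n := by have := mem_range.mp hj; omega
      rcases eq_or_lt_of_le hjle with hjeq | hjlt
      · rw [hAtop hge (by omega), mul_zero, zero_div, zero_mul]
      · have hmn' : m = 0 ∨ n = 0 := by omega
        rcases hmn' with hm | hn
        · subst hm
          rw [legendreArrDeg_fst_zero_of_ne (by omega), mul_zero]
        · subst hn
          rw [legendreArrDeg_snd_zero_of_ne (by omega), mul_zero]

end Coefficients

/-! ### 3. Uniform polynomial growth of the regularised array near the free-scalar pole -/

/-- **Uniform growth on a right neighbourhood of `Δ = 1/2`**, `ℓ = 0`: `K`, `M ≥ 0` with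
`(Δ - 1/2) · Σ_j |A_{n,j}(a,b;Δ,0)| ≤ M q_K(n)` for every `n` and all `Δ > 1/2` close to `1/2`.
[cite: DolanOsborn2004, §3 eqs. (3.9)–(3.12)] -/
theorem exists_eventually_sub_half_mul_absLevelSumAB_le (a b : ℝ) :
    ∃ (K : ℕ) (M : ℝ), 0 ≤ M ∧ ∀ᶠ Δ in 𝓝[>] (1 / 2 : ℝ), ∀ n : ℕ,
      (Δ - 1 / 2) * hrAbsLevelSumAB a b Δ 0 n ≤ M * ascWeight K n := by
  have hb : unitarityBound3D 0 = 1 / 2 := unitarityBound3D_zero'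
  have hle := nhdsGT_le_nhdsNE₂ (1 / 2 : ℝ)
  set c := max |a| |b| with hc
  have ha : |a| ≤ c := le_max_left _ _
  have hb' : |b| ≤ c := le_max_right _ _
  have hc0 : 0 ≤ c := (abs_nonneg a).trans ha
  set κ := ⌈c⌉₊ with hκ
  set K : ℕ := 40 * κ + 24 with hK
  have hKc : 40 * c + 24 ≤ (K : ℝ) := by
    have : c ≤ (κ : ℝ) := Nat.le_ceil c
    rw [hK]; push_cast; linarith
  set N₁ := ⌈abThreshold c ((3 : ℝ) / 2) 0⌉₊ with hN₁
  -- every regularised level is eventually bounded near the pole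
  have hlim : ∀ k : ℕ, ∃ L : ℝ, ∀ᶠ Δ in 𝓝[>] (1 / 2 : ℝ),
      (Δ - 1 / 2) * hrAbsLevelSumAB a b Δ 0 k ≤ L := by
    intro k
    have hT : ∀ j : ℕ, ∃ Lj : ℝ, Tendsto (fun Δ : ℝ => |(Δ - 1 / 2) * hrCoeffAB a b Δ 0 k j|)
        (𝓝[>] (1 / 2 : ℝ)) (𝓝 Lj) := fun j =>
      ⟨_, ((tendsto_sub_half_mul_hrCoeffAB_all a b k j).mono_left hle).abs⟩
    choose Lj hLj using hT
    refine ⟨∑ j ∈ range (0 + k + 1), Lj j + 1, ?_⟩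
    have hsum : Tendsto (fun Δ : ℝ => ∑ j ∈ range (0 + k + 1), |(Δ - 1 / 2) * hrCoeffAB a b Δ 0 k j|)
        (𝓝[>] (1 / 2 : ℝ)) (𝓝 (∑ j ∈ range (0 + k + 1), Lj j)) :=
      tendsto_finsetSum _ fun j _ => hLj j
    have hev := hsum.eventually (gt_mem_nhds (lt_add_one _))
    filter_upwards [hev, self_mem_nhdsWithin] with Δ hΔ hpos
    have hpos' : 0 < Δ - 1 / 2 := by
      have : (1 / 2 : ℝ) < Δ := hpos
      linarith
    have heq : (Δ - 1 / 2) * hrAbsLevelSumAB a b Δ 0 k =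
        ∑ j ∈ range (0 + k + 1), |(Δ - 1 / 2) * hrCoeffAB a b Δ 0 k j| := by
      unfold hrAbsLevelSumAB
      rw [Finset.mul_sum]
      refine Finset.sum_congr rfl fun j _ => ?_
      rw [abs_mul, abs_of_pos hpos']
    rw [heq]; exact hΔ.le
  choose L hL using hlim
  set M : ℝ := ∑ k ∈ range (N₁ + 1), max (L k) 0 with hM
  have hM0 : 0 ≤ M := Finset.sum_nonneg fun k _ => le_max_right _ _
  have hLM : ∀ k, k ≤ N₁ → L k ≤ M := fun k hk =>
    (le_max_left (L k) 0).trans (Finset.single_le_sum (f := fun k => max (L k) 0)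
      (fun k _ => le_max_right _ _) (mem_range.mpr (Nat.lt_succ_of_le hk)))
  refine ⟨K, M, hM0, ?_⟩
  have hall : ∀ᶠ Δ in 𝓝[>] (1 / 2 : ℝ), ∀ k ∈ range (N₁ + 1),
      (Δ - 1 / 2) * hrAbsLevelSumAB a b Δ 0 k ≤ L k :=
    (eventually_all_finset _).mpr fun k _ => hL k
  have hIoc : Ioc (1 / 2 : ℝ) (3 / 2) ∈ 𝓝[>] (1 / 2 : ℝ) := Ioc_mem_nhdsGT (by norm_num)
  filter_upwards [hall, hIoc] with Δ hΔ hmem n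
  have hpos : 0 < Δ - 1 / 2 := by linarith [hmem.1]
  have hne : Δ - 1 / 2 ≠ 0 := hpos.ne'
  have hΔ' : unitarityBound3D 0 < Δ := by rw [hb]; exact hmem.1
  have hthr : abThreshold c Δ 0 ≤ N₁ := by
    have hmono : abThreshold c Δ 0 ≤ abThreshold c ((3 : ℝ) / 2) 0 := by
      unfold abThreshold hrThreshold
      have h0 : 0 ≤ Δ + (2 * c + 1) + ((0 : ℕ) : ℝ) + 2 := by push_cast; linarith [hmem.1]
      have h1 : Δ + (2 * c + 1) + ((0 : ℕ) : ℝ) + 2 ≤ (3 : ℝ) / 2 + (2 * c + 1) + ((0 : ℕ) : ℝ) + 2 := by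
        linarith [hmem.2]
      exact pow_le_pow_left₀ h0 h1 2
    exact hmono.trans (Nat.le_ceil _)
  have hhead : ∀ k : ℕ, k ≤ N₁ → hrAbsLevelSumAB a b Δ 0 k ≤ M / (Δ - 1 / 2) := by
    intro k hk
    rw [le_div_iff₀ hpos, mul_comm]
    exact (hΔ k (mem_range.mpr (Nat.lt_succ_of_le hk))).trans (hLM k hk)
  have h := hrAbsLevelSumAB_le_of_bound hΔ' ha hb' hthr hKc (div_nonneg hM0 hpos.le) hhead n
  calc (Δ - 1 / 2) * hrAbsLevelSumAB a b Δ 0 n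
      ≤ (Δ - 1 / 2) * (M / (Δ - 1 / 2) * ascWeight K n) := mul_le_mul_of_nonneg_left h hpos.le
    _ = M * ascWeight K n := by rw [← mul_assoc, mul_div_cancel₀ M hne]

/-! ### 4. The value-level residue theorem at the free-scalar pole -/

/-- **Tannery at the pole, series level**: `(Δ - 1/2) · K^{ab}_{Δ,0}(z,z̄) → Σ_p freeResCoeffAB a b p z^{p₁} z̄^{p₂}`
as `Δ ↓ 1/2`, for `|z|, |z̄| < 1`. [cite: KosPolandSimmonsduffin2014, §4 eqs. (4.2)–(4.3)] -/
theorem tendsto_sub_half_mul_hrSeriesAB (a b : ℝ) {z zb : ℝ} (hz : |z| < 1) (hzb : |zb| < 1) :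
    Tendsto (fun Δ : ℝ => (Δ - 1 / 2) * hrSeriesAB a b Δ 0 z zb) (𝓝[>] (1 / 2 : ℝ))
      (𝓝 (∑' p : ℕ × ℕ, freeResCoeffAB a b p * z ^ p.1 * zb ^ p.2)) := by
  have hle := nhdsGT_le_nhdsNE₂ (1 / 2 : ℝ)
  obtain ⟨K, M, hM0, hM⟩ := exists_eventually_sub_half_mul_absLevelSumAB_le a b
  set t := max |z| |zb| with ht
  have ht0 : 0 ≤ t := le_max_of_le_left (abs_nonneg z)
  have ht1 : t < 1 := max_lt hz hzb
  have hlam := legendreLam_pos 0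
  set bound : ℕ × ℕ → ℝ := fun p =>
    M / legendreLam 0 * ((ascWeight K p.1 * t ^ p.1) * (ascWeight K p.2 * t ^ p.2)) with hbound
  have hg := summable_ascWeight_mul_pow K ht0 ht1
  have hsum : Summable bound :=
    (hg.mul_of_nonneg hg (fun m => mul_nonneg (ascWeight_pos K m).le (pow_nonneg ht0 _))
      (fun m => mul_nonneg (ascWeight_pos K m).le (pow_nonneg ht0 _))).mul_left _
  have hfun : (fun Δ : ℝ => (Δ - 1 / 2) * hrSeriesAB a b Δ 0 z zb) = fun Δ : ℝ =>
      ∑' p : ℕ × ℕ, ((Δ - 1 / 2) * hrMonomialCoeffAB a b Δ 0 p) * z ^ p.1 * zb ^ p.2 := by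
    funext Δ
    unfold hrSeriesAB
    rw [← tsum_mul_left]
    exact tsum_congr fun p => by ring
  rw [hfun]
  refine tendsto_tsum_of_dominated_convergence hsum (fun p => ?_) ?_
  · exact (((tendsto_sub_half_mul_hrMonomialCoeffAB a b p).mono_left hle).mul_const _).mul_const _
  · filter_upwards [hM, self_mem_nhdsWithin] with Δ hΔ hgt p
    have hpos : 0 < Δ - 1 / 2 := by
      have : (1 / 2 : ℝ) < Δ := hgt
      linarith
    have hk : |(Δ - 1 / 2) * hrMonomialCoeffAB a b Δ 0 p| ≤
        M / legendreLam 0 * (ascWeight K p.1 * ascWeight K p.2) := by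
      rw [abs_mul, abs_of_pos hpos]
      refine (mul_le_mul_of_nonneg_left (abs_hrMonomialCoeffAB_le a b Δ 0 p (Nat.zero_le _))
        hpos.le).trans ?_
      have hle1 : (Δ - 1 / 2) * hrAbsLevelSumAB a b Δ 0 (p.1 + p.2 - 0) ≤
          M * (ascWeight K p.1 * ascWeight K p.2) :=
        calc (Δ - 1 / 2) * hrAbsLevelSumAB a b Δ 0 (p.1 + p.2 - 0)
            ≤ M * ascWeight K (p.1 + p.2 - 0) := hΔ _
          _ ≤ M * ascWeight K (p.1 + p.2) :=
              mul_le_mul_of_nonneg_left (ascWeight_mono K (by omega)) hM0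
          _ ≤ M * (ascWeight K p.1 * ascWeight K p.2) :=
              mul_le_mul_of_nonneg_left (ascWeight_add_le K _ _) hM0
      calc (Δ - 1 / 2) * (hrAbsLevelSumAB a b Δ 0 (p.1 + p.2 - 0) / legendreLam 0)
          = (Δ - 1 / 2) * hrAbsLevelSumAB a b Δ 0 (p.1 + p.2 - 0) / legendreLam 0 := by ring
        _ ≤ M * (ascWeight K p.1 * ascWeight K p.2) / legendreLam 0 :=
            div_le_div_of_nonneg_right hle1 hlam.le
        _ = M / legendreLam 0 * (ascWeight K p.1 * ascWeight K p.2) := by ring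
    have hq : 0 ≤ M / legendreLam 0 * (ascWeight K p.1 * ascWeight K p.2) :=
      mul_nonneg (div_nonneg hM0 hlam.le) (mul_nonneg (ascWeight_pos _ _).le (ascWeight_pos _ _).le)
    have hzp : |z| ^ p.1 ≤ t ^ p.1 := pow_le_pow_left₀ (abs_nonneg z) (le_max_left _ _) _
    have hzbp : |zb| ^ p.2 ≤ t ^ p.2 := pow_le_pow_left₀ (abs_nonneg zb) (le_max_right _ _) _
    rw [Real.norm_eq_abs, abs_mul, abs_mul, abs_pow, abs_pow]
    calc |(Δ - 1 / 2) * hrMonomialCoeffAB a b Δ 0 p| * |z| ^ p.1 * |zb| ^ p.2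
        ≤ (M / legendreLam 0 * (ascWeight K p.1 * ascWeight K p.2)) * t ^ p.1 * t ^ p.2 :=
          mul_le_mul (mul_le_mul hk hzp (pow_nonneg (abs_nonneg _) _) hq) hzbp
            (pow_nonneg (abs_nonneg _) _) (mul_nonneg hq (pow_nonneg ht0 _))
      _ = bound p := by rw [hbound]; ring

/-- **The limit series is `z z̄` times the residue block's series**:
`Σ_p freeResCoeffAB a b p z^{p₁} z̄^{p₂} = freeScalarResidueConst a b · z z̄ · K^{ab}_{5/2,0}(z,z̄)` on the unit
bidisk. [cite: KosPolandSimmonsduffin2014, §4 eqs. (4.2)–(4.3)] -/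
theorem hasSum_freeResCoeffAB (a b : ℝ) {z zb : ℝ} (hz : |z| < 1) (hzb : |zb| < 1) :
    HasSum (fun p : ℕ × ℕ => freeResCoeffAB a b p * z ^ p.1 * zb ^ p.2)
      (freeScalarResidueConst a b * (z * zb) * hrSeriesAB a b (5 / 2) 0 z zb) := by
  have hS := isDoublePowerSeriesOn_hrSeriesAB (a := a) (b := b) unitarityBound3D_zero_lt_five_halves
  have hsum : Summable fun p : ℕ × ℕ => hrMonomialCoeffAB a b (5 / 2) 0 p * z ^ p.1 * zb ^ p.2 := by
    refine (hS z zb hz hzb).1.of_norm_bounded fun p => ?_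
    rw [Real.norm_eq_abs, abs_mul, abs_mul, abs_pow, abs_pow]
  have h0 : HasSum (fun p : ℕ × ℕ => hrMonomialCoeffAB a b (5 / 2) 0 p * z ^ p.1 * zb ^ p.2)
      (hrSeriesAB a b (5 / 2) 0 z zb) := hsum.hasSum
  have h1 : HasSum (fun p : ℕ × ℕ =>
      freeScalarResidueConst a b * hrMonomialCoeffAB a b (5 / 2) 0 (p.1 + 1 - 1, p.2 + 1 - 1) *
        z ^ (p.1 + 1) * zb ^ (p.2 + 1))
      (freeScalarResidueConst a b * (z * zb) * hrSeriesAB a b (5 / 2) 0 z zb) := by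
    have hfun : (fun p : ℕ × ℕ =>
        freeScalarResidueConst a b * hrMonomialCoeffAB a b (5 / 2) 0 (p.1 + 1 - 1, p.2 + 1 - 1) *
          z ^ (p.1 + 1) * zb ^ (p.2 + 1)) = fun p : ℕ × ℕ =>
        freeScalarResidueConst a b * (z * zb) *
          (hrMonomialCoeffAB a b (5 / 2) 0 p * z ^ p.1 * zb ^ p.2) := by
      funext p
      simp only [Nat.add_sub_cancel, pow_succ]
      ring
    rw [hfun]
    exact h0.mul_left _
  have h2 := hasSum_shift11 (G := fun q : ℕ × ℕ =>
    freeScalarResidueConst a b * hrMonomialCoeffAB a b (5 / 2) 0 (q.1 - 1, q.2 - 1) * z ^ q.1 * zb ^ q.2) h1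
  have hfun2 : (fun p : ℕ × ℕ => freeResCoeffAB a b p * z ^ p.1 * zb ^ p.2) = fun q : ℕ × ℕ =>
      if 1 ≤ q.1 ∧ 1 ≤ q.2 then
        freeScalarResidueConst a b * hrMonomialCoeffAB a b (5 / 2) 0 (q.1 - 1, q.2 - 1) * z ^ q.1 * zb ^ q.2
      else 0 := by
    funext q
    rw [freeResCoeffAB_eq a b q]
    split_ifs <;> ring
  rw [hfun2]
  exact h2

/-- **The residue constant of the typed block** `g^{Δ₁₂,Δ₃₄}_{Δ,0}` at the free-scalar pole `Δ = 1/2`,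
relative to the typed block `g^{Δ₁₂,Δ₃₄}_{5/2,0}`: `(4Δ₁₂² - 1)(4Δ₃₄² - 1)/192`
(`= freeScalarResidueConst (-Δ₁₂/2) (Δ₃₄/2)`). [cite: KosPolandSimmonsduffin2014, §4 Table 1] -/
noncomputable def freeScalarBlockResidueConst (Δ₁₂ Δ₃₄ : ℝ) : ℝ :=
  (4 * Δ₁₂ ^ 2 - 1) * (4 * Δ₃₄ ^ 2 - 1) / 192

/-- Agreement with the array-level constant. [cite: KosPolandSimmonsduffin2014, §4 Table 1] -/
theorem freeScalarResidueConst_half (Δ₁₂ Δ₃₄ : ℝ) :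
    freeScalarResidueConst (-Δ₁₂ / 2) (Δ₃₄ / 2) = freeScalarBlockResidueConst Δ₁₂ Δ₃₄ := by
  unfold freeScalarResidueConst freeScalarBlockResidueConst
  ring

/-- The constant is non-zero exactly when `|Δ₁₂| ≠ 1/2` and `|Δ₃₄| ≠ 1/2`. [cite: KosPolandSimmonsduffin2014, §4 Table 1] -/
theorem freeScalarBlockResidueConst_ne_zero {Δ₁₂ Δ₃₄ : ℝ}
    (h : (4 * Δ₁₂ ^ 2 - 1) * (4 * Δ₃₄ ^ 2 - 1) ≠ 0) : freeScalarBlockResidueConst Δ₁₂ Δ₃₄ ≠ 0 := by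
  unfold freeScalarBlockResidueConst
  exact div_ne_zero h (by norm_num)

/-- **The value-level residue theorem at the free-scalar pole** (Kos–Poland–Simmons-Duffin 2014 §4, type II,
`k = 1`, `d = 3`): for every `Δ₁₂, Δ₃₄` and every point of the open square,
`(Δ - 1/2) · g^{Δ₁₂,Δ₃₄}_{Δ,0}(z,z̄) → freeScalarBlockResidueConst Δ₁₂ Δ₃₄ · g^{Δ₁₂,Δ₃₄}_{5/2,0}(z,z̄)` as
`Δ ↓ 1/2`, `g = hrBlockAB` the typed block. [cite: KosPolandSimmonsduffin2014, §4 eqs. (4.2)–(4.3)] -/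
theorem tendsto_sub_half_mul_hrBlockAB (Δ₁₂ Δ₃₄ : ℝ) {z zb : ℝ}
    (hz : z ∈ Ioo (0 : ℝ) 1) (hzb : zb ∈ Ioo (0 : ℝ) 1) :
    Tendsto (fun Δ : ℝ => (Δ - 1 / 2) * hrBlockAB Δ₁₂ Δ₃₄ Δ 0 z zb) (𝓝[>] (1 / 2 : ℝ))
      (𝓝 (freeScalarBlockResidueConst Δ₁₂ Δ₃₄ * hrBlockAB Δ₁₂ Δ₃₄ (5 / 2) 0 z zb)) := by
  have hzabs : |z| < 1 := by rw [abs_of_pos hz.1]; exact hz.2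
  have hzbabs : |zb| < 1 := by rw [abs_of_pos hzb.1]; exact hzb.2
  have hx : 0 < z * zb := mul_pos hz.1 hzb.1
  have hpow : Tendsto (fun Δ : ℝ => (z * zb) ^ ((Δ - ((0 : ℕ) : ℝ)) / 2)) (𝓝[>] (1 / 2 : ℝ))
      (𝓝 ((z * zb) ^ (((1 / 2 : ℝ) - ((0 : ℕ) : ℝ)) / 2))) := by
    have hc : Continuous fun Δ : ℝ => (z * zb) ^ ((Δ - ((0 : ℕ) : ℝ)) / 2) :=
      (Real.continuous_const_rpow hx.ne').comp ((continuous_id.sub continuous_const).div_const _)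
    exact hc.continuousAt.tendsto.mono_left nhdsWithin_le_nhds
  have hser : Tendsto (fun Δ : ℝ => (Δ - 1 / 2) * hrSeriesAB (-Δ₁₂ / 2) (Δ₃₄ / 2) Δ 0 z zb)
      (𝓝[>] (1 / 2 : ℝ))
      (𝓝 (freeScalarResidueConst (-Δ₁₂ / 2) (Δ₃₄ / 2) * (z * zb) *
        hrSeriesAB (-Δ₁₂ / 2) (Δ₃₄ / 2) (5 / 2) 0 z zb)) := by
    rw [← (hasSum_freeResCoeffAB (-Δ₁₂ / 2) (Δ₃₄ / 2) hzabs hzbabs).tsum_eq]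
    exact tendsto_sub_half_mul_hrSeriesAB _ _ hzabs hzbabs
  have hprod := hpow.mul hser
  have hfun : (fun Δ : ℝ => (Δ - 1 / 2) * hrBlockAB Δ₁₂ Δ₃₄ Δ 0 z zb) = fun Δ : ℝ =>
      (z * zb) ^ ((Δ - ((0 : ℕ) : ℝ)) / 2) *
        ((Δ - 1 / 2) * hrSeriesAB (-Δ₁₂ / 2) (Δ₃₄ / 2) Δ 0 z zb) := by
    funext Δ; unfold hrBlockAB; ring
  rw [hfun]
  refine hprod.congr' (Eventually.of_forall fun _ => rfl) |>.mono_right (le_of_eq ?_)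
  congr 1
  unfold hrBlockAB
  rw [← freeScalarResidueConst_half]
  have he1 : (((1 / 2 : ℝ)) - ((0 : ℕ) : ℝ)) / 2 = (1 : ℝ) / 4 := by push_cast; ring
  have he2 : (((5 : ℝ) / 2) - ((0 : ℕ) : ℝ)) / 2 = (1 : ℝ) / 4 + 1 := by push_cast; ring
  rw [he1, he2, Real.rpow_add hx, Real.rpow_one]
  ring

/-! ### 5. Non-existence of the typed block at the free-scalar point -/

/-- **No block at the free-scalar pole.** For `|Δ₁₂| ≠ 1/2` and `|Δ₃₄| ≠ 1/2` no function satisfies the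
typed predicate `IsConformalBlock3D Δ₁₂ Δ₃₄ (1/2) 0`: the point is the scalar unitarity bound (not regular),
and the limit clause fails because the generic blocks `g_{Δ',0} = hrBlockAB` (uniqueness at the regular
points `Δ' ↓ 1/2`) have `(Δ' - 1/2) g_{Δ',0} → freeScalarBlockResidueConst · g_{5/2,0} ≠ 0` somewhere on
the square. [cite: KosPolandSimmonsduffin2014, §4 eqs. (4.2)–(4.3)] -/
theorem not_isConformalBlock3D_freeScalar {Δ₁₂ Δ₃₄ : ℝ}
    (h12 : (4 * Δ₁₂ ^ 2 - 1) * (4 * Δ₃₄ ^ 2 - 1) ≠ 0) (g : ℝ → ℝ → ℝ) :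
    ¬ IsConformalBlock3D Δ₁₂ Δ₃₄ (1 / 2) 0 g := by
  have hb : unitarityBound3D 0 = 1 / 2 := unitarityBound3D_zero'
  rintro (⟨hreg, -⟩ | ⟨-, G, hG, hlim⟩)
  · exact hreg.1 hb.symm
  · obtain ⟨z, zb, hz, hzb, hne⟩ :=
      exists_hrBlockAB_ne_zero Δ₁₂ Δ₃₄ (ℓ := 0) (Δ := (5 : ℝ) / 2) unitarityBound3D_zero_lt_five_halves
    have hev : ∀ᶠ Δ in 𝓝[>] (1 / 2 : ℝ), G Δ z zb = hrBlockAB Δ₁₂ Δ₃₄ Δ 0 z zb := by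
      have h1 := eventually_isRegularPoint3D_nhdsGT_of_bound_le (le_of_eq hb)
      have h2 : ∀ᶠ Δ in 𝓝[>] (1 / 2 : ℝ), Δ ∈ Ioo (1 / 2 : ℝ) (1 / 2 + 1) :=
        Ioo_mem_nhdsGT (by norm_num)
      filter_upwards [h1, h2] with Δ hreg hΔ
      have hlt : unitarityBound3D 0 < Δ := by rw [hb]; exact hΔ.1
      exact (hG Δ hΔ).eq_hrBlockAB hlt hreg.2 z zb hz hzb
    have hA : Tendsto (fun Δ : ℝ => (Δ - 1 / 2) * G Δ z zb) (𝓝[>] (1 / 2 : ℝ)) (𝓝 0) := by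
      have hc : Tendsto (fun Δ : ℝ => Δ - 1 / 2) (𝓝[>] (1 / 2 : ℝ)) (𝓝 0) := by
        have hcont : Continuous (fun Δ : ℝ => Δ - 1 / 2) := by fun_prop
        exact (hcont.tendsto' (1 / 2) 0 (by simp)).mono_left nhdsWithin_le_nhds
      simpa using hc.mul (hlim z zb hz hzb)
    have hB : Tendsto (fun Δ : ℝ => (Δ - 1 / 2) * G Δ z zb) (𝓝[>] (1 / 2 : ℝ))
        (𝓝 (freeScalarBlockResidueConst Δ₁₂ Δ₃₄ * hrBlockAB Δ₁₂ Δ₃₄ (5 / 2) 0 z zb)) :=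
      (tendsto_sub_half_mul_hrBlockAB Δ₁₂ Δ₃₄ hz hzb).congr'
        (by filter_upwards [hev] with Δ h; rw [h])
    have huniq := tendsto_nhds_unique hA hB
    exact mul_ne_zero (freeScalarBlockResidueConst_ne_zero h12) hne huniq.symm

/-- Equal external dimensions: **no typed block at `(1/2, 0)` for `Δ₁₂ = Δ₃₄ = 0`** — a free scalar cannot
be exchanged between two identical scalars. [cite: KosPolandSimmonsduffin2014, §4 eqs. (4.2)–(4.3)] -/
theorem not_isConformalBlock3D_freeScalar_zero_zero (g : ℝ → ℝ → ℝ) :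
    ¬ IsConformalBlock3D 0 0 (1 / 2) 0 g :=
  not_isConformalBlock3D_freeScalar (by norm_num) g

/-- **Satisfiability at the scalar bound, both directions** (for `|Δ₁₂|, |Δ₃₄| ≠ 1/2`): for `Δ₀ ≥ 1/2` the
typed predicate `IsConformalBlock3D Δ₁₂ Δ₃₄ Δ₀ 0` has a solution iff `Δ₀ ≠ 1/2` (existence above the bound:
`BlockExistenceLimitAB`). [cite: KosPolandSimmonsduffin2014, §4 eqs. (4.2)–(4.3)] -/
theorem exists_isConformalBlock3D_scalar_iff_ne_half {Δ₁₂ Δ₃₄ : ℝ}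
    (h12 : (4 * Δ₁₂ ^ 2 - 1) * (4 * Δ₃₄ ^ 2 - 1) ≠ 0) {Δ₀ : ℝ} (hΔ₀ : 1 / 2 ≤ Δ₀) :
    (∃ g : ℝ → ℝ → ℝ, IsConformalBlock3D Δ₁₂ Δ₃₄ Δ₀ 0 g) ↔ Δ₀ ≠ 1 / 2 := by
  constructor
  · rintro ⟨g, hg⟩ h0
    rw [h0] at hg
    exact not_isConformalBlock3D_freeScalar h12 g hg
  · intro hne
    have hlt : unitarityBound3D 0 < Δ₀ := by
      rw [unitarityBound3D_zero']
      exact lt_of_le_of_ne hΔ₀ (Ne.symm hne)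
    exact exists_isConformalBlock3D_of_lt Δ₁₂ Δ₃₄ hlt

/-! ### 6. Consequence for the typed `σ–ε` data -/

namespace SigmaEpsilonData

/-- **Clause A2 excludes a dimension-`1/2` scalar from `σ × σ` and `ε × ε`**: under the typed bootstrap
axioms every `ℤ₂`-even exchanged scalar has `Δ > 1/2` — the free scalar is removed exactly as the equation of
motion removes it in a CFT. [cite: KosPolandSimmonsduffin2014, §4 eqs. (4.2)–(4.3)] -/
theorem half_lt_Δp_of_satisfiesBootstrapAxioms (D : SigmaEpsilonData) (hD : D.SatisfiesBootstrapAxioms)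
    (i : D.ιp) (hℓ : D.ℓp i = 0) : 1 / 2 < D.Δp i := by
  have hu : unitarityBound3D (D.ℓp i) ≤ D.Δp i := hD.2.1.2.2.1 i
  rw [hℓ, unitarityBound3D_zero'] at hu
  refine lt_of_le_of_ne hu (Ne.symm fun h => ?_)
  have hg := hD.1.1 i
  rw [hℓ, h] at hg
  exact not_isConformalBlock3D_freeScalar_zero_zero (D.gp i) hg

/-- **Odd sector**: if `|Δ_σ - Δ_ε| ≠ 1/2`, every `ℤ₂`-odd exchanged scalar has `Δ > 1/2` as well (the
`⟨εσσε⟩` family `gpm`, `Δ₁₂ = -Δ_σε`, `Δ₃₄ = Δ_σε`). At `|Δ_σ - Δ_ε| = 1/2` the residue vanishes and nothing is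
excluded (`σ = φ`, `ε = φ²`: the free scalar does couple to `φ × φ²`). [cite: KosPolandSimmonsduffin2014, §4 eqs. (4.2)–(4.3)] -/
theorem half_lt_Δm_of_satisfiesBootstrapAxioms (D : SigmaEpsilonData) (hD : D.SatisfiesBootstrapAxioms)
    (hs : 4 * D.Δσε ^ 2 ≠ 1) (j : D.ιm) (hℓ : D.ℓm j = 0) : 1 / 2 < D.Δm j := by
  have hu : unitarityBound3D (D.ℓm j) ≤ D.Δm j := hD.2.1.2.2.2.2 j
  rw [hℓ, unitarityBound3D_zero'] at hu
  refine lt_of_le_of_ne hu (Ne.symm fun h => ?_)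
  have hg := hD.1.2.2 j
  rw [hℓ, h] at hg
  have h12 : (4 * (-D.Δσε) ^ 2 - 1) * (4 * D.Δσε ^ 2 - 1) ≠ 0 := by
    have h1 : 4 * D.Δσε ^ 2 - 1 ≠ 0 := sub_ne_zero.mpr hs
    rw [neg_sq]
    exact mul_ne_zero h1 h1
  exact not_isConformalBlock3D_freeScalar h12 (D.gpm j) hg

end SigmaEpsilonData

end Literature.MathematicalPhysics.QuantumFieldTheory.ConformalBootstrap3D
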